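import Summits.NavierStokesRegularity.NavierStokesRegularity.Theorems.TaoLadderRungTwoFlatGaugeCaptureDefs
import Summits.NavierStokesRegularity.NavierStokesRegularity.Theorems.TaoLadderRungThreeGappedFrontRobustGaussianWeights
import HarnessLib

/-!
# HOP-INVARIANT-50 — the typed per-hop induction hypothesis `H(n)` for child 2 (`GradedAdiabaticWake`,
  item stmt-NavierStokesRegularity-23909) of the K_A♭ split of route TaoLadderRungTwoFlat
  (cell harvest/h2-tao-ladder, theory-1 g38, numT50; LADDER §50)

WHAT THIS FILE FIXES. The reference set of the format-v2 certificate (`GapData₂On … Z …`) for the graded mirror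
lattice is DESCRIBED as a union of hop-indexed tubes, `Z = ⋃ₙ Zₙ`, `Zₙ = {z | InTube … n z}` («`H(n)` holds for
`z`»): `n = 0` the normalised datum; `1 ≤ n ≤ N₀` the CAPTURE phase (sup-ball of radius `η n` around the canonical
checkpoint state `ζ n` of the graded datum solution); `n > N₀` the TUBE proper, by zones — ANCHOR (`|z i₀ 0| = A_*`:
the canonical re-centring divides by `a := |S i₀ 1 τ₁| / A_*`), CORE (gauge distance `≤ δ n` to the persisted
pulse section state `u⋆` on the half-line `k ≥ -K`, gauge `MirrorPulse.geomGauge g b`), NEAR-BEHIND (co-moving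
deviation energy on the block `[-D, -K-1]` with weight `e^{θ_V (k+K)}`, budget `v n`), BEHIND (sup envelope
`A n · (1+ε₀)^{θ_b |k|}` on `k < -K`, `TameBehind`-compatible), AHEAD (`8·w k·|z i k| ≤ r` from shell `k₁`).
The step is taken with a CANONICAL rule `(τ₁, a) = (rule.τ₁ n S, rule.a n S)` (the prover's choice — NOT the
closure under all legal checkpoints, which is refutable by deflation: numT50/ReachDeflation50.lean).

THE COMPOSITION (kernel-checked, no `sorry`): named per-zone obligations
`TubeStepClock/Envelope/Capture/Entry/Anchor/Core/Near/Behind/Ahead n` + statics + existence ⇒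
`GapData₂On 𝕊 σ ε₀ i₀ α X₀ (tubeSet …) w r 0 θ₀ θ c₀ c env₀` (`gapData₂On_of_tube`). The obligations are the
targets of the analytic lane's lemmas L1–L8 (LADDER §47.5, §49, §50.3); nothing here proves any of them.

HONEST FRAMING: MODEL lattice (graded mirror table on `S♭`); the SHAPE of an induction hypothesis and its
bookkeeping; nothing certified; nothing about the Navier–Stokes equations.

PROVENANCE (p1 g21): theory-1 g38's image of record numT50/HopInvariant50.lean sha16 5ce486f7c5cf379d (841 l.), landed
with declarations BYTE-IDENTICAL (+ one lint docstring on `datum_mem_tubeSet`) in THREE modules (400-line lint) under the namespace `…Theorems.HopTube` — renamed from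
`…Theorems.HopInvariant` because the SUPERSEDED first image (1bc3dc6f836c89b6, p686196/p686561, referee W-16: exact
anchor rule with the entry-ratio trap) occupies that namespace. Part 1 = this module (schedule, clauses, obligations,
composition); part 2 = `…HopTubeStatics` (boundedness, statics); part 3 = `…HopTubeCanonical` (clamped anchor algebra,
canonical rule, Gaussian tube weight). IMPORTS (p1 g21, referee W-16′): the route-dependent `…ReachClosure` import of the
first landing is replaced by the frozen image's route-independent imports (no `Theses` file in the cone); decls unchanged.
-/

noncomputable section

set_option linter.dupNamespace false

namespace Summit.NavierStokesRegularity.NavierStokesRegularity.Theorems.HopTube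

open Set Finset Literature.Analysis.FluidPDE Literature.Analysis.FluidPDE.TaoCascade

/-- The schedule of tube constants: capture length `N₀`, core window `K`, near-behind depth `D`, tail shell `k₁`,
depth offset `K₂` of the behind-envelope cap (every tube state is BOUNDED: the format's a-priori clause (4.5) lets
exact flows start only from sup-bounded states), gauge parameters `g, b`, anchor `A_*`, behind exponent `θ_b`,
co-moving rate `θ_V`, and per-hop budgets `δ, v, A, η : ℕ → ℝ` (core radius, near energy, behind envelope constant,
capture radius).
[cite: Tao2016AveragedNS, §6.3–6.4 (statement shape); cell TRANSFER-CONSTANTS §1, LADDER §50] -/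
structure TubeSchedule where
  N₀ : ℕ
  K : ℕ
  D : ℕ
  k₁ : ℕ
  K₂ : ℕ
  g : ℝ
  b : ℝ
  Astar : ℝ
  γ : ℕ → ℝ
  θb : ℝ
  θV : ℝ
  δ : ℕ → ℝ
  v : ℕ → ℝ
  A : ℕ → ℝ
  η : ℕ → ℝ

/-- A CANONICAL checkpoint rule: the prover's own re-centring time and ratio as functions of the hop count `n` and the flow
(`a = 1` in the capture phase; from the entry hop on the CLAMPED anchor normalisation
`a = max((1+ε₀)^{-θ₀}, |S i₀ 1 τ₁| / A_*)`, which honours the format's ratio floor by construction and lets the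
anchor float in the band `[A_*(1-γ), A_*]` along the pulse family's neutral scaling direction).
[cite: Tao2016AveragedNS, §6.4 Prop. 6.5 (statement shape of the checkpoint step); cell TRANSFER-CONSTANTS §1, §4] -/
structure HopRule where
  τ₁ : ℕ → (Fin 2 → ℤ → ℝ → ℝ) → ℝ
  a : ℕ → (Fin 2 → ℤ → ℝ → ℝ) → ℝ

/-- The re-centred state after a checkpoint `(τ₁, a)`. [cite: Tao2016AveragedNS, §6.4 (re-centring at a checkpoint); cell certificate format v2] -/
def recentre (S : Fin 2 → ℤ → ℝ → ℝ) (τ₁ a : ℝ) : Fin 2 → ℤ → ℝ := fun i k => S i (1 + k) τ₁ / a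

/-- ANCHOR clause (BANDED): the observable carrier at the front shell has modulus in `[A_*(1-γ), A_*]`. The band is
the pulse family's neutral SCALING direction (`κΦ` is a pulse for every `κ > 0`): exact re-anchoring to `A_*` at every
hop would violate the ratio floor `(1+ε₀)^{-θ₀} ≤ a` at the early post-capture hops (a state `δ̄`-off the pulse hops with
carrier ratio `1 ± Cδ̄`, and `δ̄` is `ε₀`-free while the floor tends to `1`), so the rule clamps `a` at the floor and the
anchor deficit `1 - |z i₀ 0|/A_* ≤ γ n` absorbs the difference (a NONDECREASING schedule `γ n ↑ Γ`: clamped hops add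
their ratio shortfall, cumulatively `≤ C Σₙ δ n + …`, `ε₀`-free and small).
[cite: Tao2016AveragedNS, §6.4; cell TRANSFER-CONSTANTS §4 (anchor bookkeeping); cell LADDER §50] -/
def AnchorClause (P : TubeSchedule) (i₀ : Fin 2) (n : ℕ) (z : Fin 2 → ℤ → ℝ) : Prop :=
  P.Astar * (1 - P.γ n) ≤ |z i₀ 0| ∧ |z i₀ 0| ≤ P.Astar

/-- The state's own scale along the neutral direction, read off the anchor coordinate: `x(z) = |z i₀ 0| / A_*`.
[cite: Tao2016AveragedNS, §6.3 (modulation parameters, statement shape); cell LADDER §50] -/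
def anchorScale (P : TubeSchedule) (i₀ : Fin 2) (z : Fin 2 → ℤ → ℝ) : ℝ := |z i₀ 0| / P.Astar

/-- CORE clause at hop `n`: gauge distance, on `k ≥ -K`, to the SCALED reference section state `x(z)·u⋆` (the member
of the pulse family selected by the state's own anchor coordinate; `u⋆` is normalised to `|u⋆ i₀ 0| = A_*`). The
deviation TRANSVERSAL to the two neutral directions (scaling: read off here; time translation: killed by the rule's
section condition) is what the linearised hop contraction shrinks. [cite: Tao2016AveragedNS, §6.3–6.4; cell LADDER §47.5 L3/L4, §50] -/
def CoreClause (P : TubeSchedule) (i₀ : Fin 2) (ustar : Fin 2 → ℤ → ℝ) (n : ℕ) (z : Fin 2 → ℤ → ℝ) : Prop :=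
  ∀ (i : Fin 2) (k : ℤ), -(P.K : ℤ) ≤ k →
    MirrorPulse.geomGauge P.g P.b i k * |z i k - anchorScale P i₀ z * ustar i k| ≤ P.δ n

/-- NEAR-BEHIND clause at hop `n`: co-moving deviation energy on the block `[-D, -K-1]` (weight `e^{θ_V (k+K)}`,
decaying into the behind) at most `v n`. [cite: Tao2016AveragedNS, §6.3–6.4; cell LADDER §49 (L8b), §50] -/
def NearClause (P : TubeSchedule) (i₀ : Fin 2) (ustar : Fin 2 → ℤ → ℝ) (n : ℕ) (z : Fin 2 → ℤ → ℝ) : Prop :=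
  ∑ k ∈ Finset.Icc (-(P.D : ℤ)) (-(P.K : ℤ) - 1),
      Real.exp (P.θV * ((k : ℝ) + P.K)) * ∑ i : Fin 2, (z i k - anchorScale P i₀ z * ustar i k) ^ 2 / 2 ≤ P.v n

/-- BEHIND clause at hop `n`: sup envelope `A n · (1+ε₀)^{θ_b · min(|k|, n + K₂)}` on every shell `k < -K` (near
and far); the growth is CAPPED at depth `n + K₂` (below the datum's original shell only back-scattered energy lives),
so every tube state is bounded, as the format's a-priori clause (4.5) requires of any state an exact flow starts from.
[cite: Tao2016AveragedNS, §4 Lemma 4.1 (4.5), §6.3–6.4; cell LADDER §47.5 L6, §50] -/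
def BehindClause (P : TubeSchedule) (ε₀ : ℝ) (n : ℕ) (z : Fin 2 → ℤ → ℝ) : Prop :=
  ∀ (i : Fin 2) (k : ℤ), k < -(P.K : ℤ) →
    |z i k| ≤ P.A n * (1 + ε₀) ^ (P.θb * min |(k : ℝ)| ((n : ℝ) + P.K₂))

/-- AHEAD clause: from shell `k₁` on, `8 · w k · |z i k| ≤ r` (the `TailFat` state clause with margin).
[cite: Tao2016AveragedNS, §6.2 Prop. 6.3 (ix); cell LADDER §47.5 L1, §50] -/
def AheadClause (P : TubeSchedule) (w : ℤ → ℝ) (r : ℝ) (z : Fin 2 → ℤ → ℝ) : Prop :=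
  ∀ (i : Fin 2) (k : ℤ), (P.k₁ : ℤ) ≤ k → 8 * (w k * |z i k|) ≤ r

/-- CAPTURE clause at hop `n` (`1 ≤ n ≤ N₀`): sup-ball of radius `η n` around the canonical checkpoint state `ζ n`
of the graded datum solution (paired with `AheadClause` in `InTube`, so capture states have thin tails too). [cite: Tao2016AveragedNS, §6.3–6.4; cell LADDER §47.5 L3 (finite-time continuity), §50] -/
def CaptureClause (P : TubeSchedule) (ζ : ℕ → Fin 2 → ℤ → ℝ) (n : ℕ) (z : Fin 2 → ℤ → ℝ) : Prop :=
  ∀ (i : Fin 2) (k : ℤ), |z i k - ζ n i k| ≤ P.η n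

/-- **`H(n)`: the state `z` is in the hop-`n` tube.** [cite: Tao2016AveragedNS, §6.3–6.4 (statement shape); cell LADDER §50] -/
def InTube (P : TubeSchedule) (ε₀ : ℝ) (i₀ : Fin 2) (X₀ : Fin 2 → ℝ) (w : ℤ → ℝ) (r : ℝ)
    (ζ : ℕ → Fin 2 → ℤ → ℝ) (ustar : Fin 2 → ℤ → ℝ) (n : ℕ) (z : Fin 2 → ℤ → ℝ) : Prop :=
  if n = 0 then z = datumState i₀ X₀
  else if n ≤ P.N₀ then CaptureClause P ζ n z ∧ AheadClause P w r z
  else AnchorClause P i₀ n z ∧ CoreClause P i₀ ustar n z ∧ NearClause P i₀ ustar n z ∧ BehindClause P ε₀ n z ∧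
    AheadClause P w r z

/-- The described reference set `Z = ⋃ₙ {z | H(n) z}`. [cite: Tao2016AveragedNS, §6.3–6.4 (statement shape); cell LADDER §50] -/
def tubeSet (P : TubeSchedule) (ε₀ : ℝ) (i₀ : Fin 2) (X₀ : Fin 2 → ℝ) (w : ℤ → ℝ) (r : ℝ)
    (ζ : ℕ → Fin 2 → ℤ → ℝ) (ustar : Fin 2 → ℤ → ℝ) : Set (Fin 2 → ℤ → ℝ) :=
  {z | ∃ n, InTube P ε₀ i₀ X₀ w r ζ ustar n z}

/-- The normalised datum is a hop-`0` tube state. [cite: Tao2016AveragedNS, §6.4 Prop. 6.5 (statement shape); cell LADDER §50] -/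
theorem datum_mem_tubeSet (P : TubeSchedule) (ε₀ : ℝ) (i₀ : Fin 2) (X₀ : Fin 2 → ℝ) (w : ℤ → ℝ) (r : ℝ)
    (ζ : ℕ → Fin 2 → ℤ → ℝ) (ustar : Fin 2 → ℤ → ℝ) :
    datumState i₀ X₀ ∈ tubeSet P ε₀ i₀ X₀ w r ζ ustar :=
  ⟨0, by simp [InTube]⟩

/-! ## The per-hop obligations (targets of the analytic lane), relative to a canonical rule -/

section Obligations

variable (P : TubeSchedule) (rule : HopRule) (𝕊 : Finset (ℤ × ℤ × ℤ)) (σ ε₀ : ℝ) (i₀ : Fin 2)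
  (α : Fin 2 → Fin 2 → Fin 2 → ℤ × ℤ × ℤ → ℝ) (X₀ : Fin 2 → ℝ) (w : ℤ → ℝ) (r θ₀ c₀ : ℝ) (env₀ : ℤ → ℝ)
  (ζ : ℕ → Fin 2 → ℤ → ℝ) (ustar : Fin 2 → ℤ → ℝ)

/-- The common premise of every hop obligation at hop `n`: a tube state `z`, a kicked start `S₀` in its weighted
`r`-ball, and an exact format flow of duration `τ ≥ c₀` from `S₀`. [cite: Tao2016AveragedNS, §6.4 Prop. 6.5 (statement shape); cell certificate format v2] -/
def HopPremise (n : ℕ) (z S₀ : Fin 2 → ℤ → ℝ) (τ : ℝ) (S F : Fin 2 → ℤ → ℝ → ℝ) : Prop :=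
  InTube P ε₀ i₀ X₀ w r ζ ustar n z ∧ (∀ i k, w k * |S₀ i k - z i k| ≤ r) ∧ c₀ ≤ τ ∧
    PseudoFlowOnShift 𝕊 τ ε₀ α 0 0 S₀ (fun i k => (1 / 2) * S₀ i k ^ 2) (fun _ _ => 0) S F

/-- CLOCK/RATIO/SLACK obligation: the rule fires within the clock `c₀`, with positive ratio above the floor
`(1+ε₀)^{-θ₀}`, not above the landing carrier, and with slack `σ`. (L3/L4 + anchor bookkeeping.)
[cite: Tao2016AveragedNS, §6.4 Prop. 6.5; cell TRANSFER-CONSTANTS §4] -/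
def TubeStepClock (n : ℕ) : Prop :=
  ∀ z S₀ τ S F, HopPremise P 𝕊 ε₀ i₀ α X₀ w r c₀ ζ ustar n z S₀ τ S F →
    0 < rule.τ₁ n S ∧ rule.τ₁ n S ≤ c₀ ∧ 0 < rule.a n S ∧ (1 + ε₀) ^ (-θ₀) ≤ rule.a n S ∧
      rule.a n S ≤ |S i₀ 1 (rule.τ₁ n S)| ∧ (1 + σ) * rule.a n S ≤ |S i₀ 1 (rule.τ₁ n S)|

/-- ENVELOPE obligation: shell energies under `env₀` on `[0, τ₁]`. (L1/L5: exact-flow envelope.)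
[cite: Tao2016AveragedNS, §6.4 Prop. 6.5 (iv); cell TRANSFER-CONSTANTS §2] -/
def TubeStepEnvelope (n : ℕ) : Prop :=
  ∀ z S₀ τ S F, HopPremise P 𝕊 ε₀ i₀ α X₀ w r c₀ ζ ustar n z S₀ τ S F →
    ∀ s ∈ Icc 0 (rule.τ₁ n S), epochEnvelope env₀ (fun i k => S i k s) (fun i k => F i k s)

/-- CAPTURE obligation (`n + 1 ≤ N₀`): landing in the next capture ball, with the ahead (tail) clause. (L3:
finite-time continuity in the datum and in `ε₀`; L1 for the tail.) [cite: Tao2016AveragedNS, §6.2 Prop. 6.3 (ix), §6.3–6.4; cell LADDER §47.5 L1/L3] -/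
def TubeStepCapture (n : ℕ) : Prop :=
  ∀ z S₀ τ S F, HopPremise P 𝕊 ε₀ i₀ α X₀ w r c₀ ζ ustar n z S₀ τ S F →
    CaptureClause P ζ (n + 1) (recentre S (rule.τ₁ n S) (rule.a n S)) ∧
      AheadClause P w r (recentre S (rule.τ₁ n S) (rule.a n S))

/-- TUBE LANDING obligation (`n ≥ N₀`, covers the ENTRY hop `n = N₀` from the last capture ball and every later
hop): anchor, core, near-behind, behind and ahead clauses of `H(n+1)` for the re-centred state. Split below into
its five zone obligations. [cite: Tao2016AveragedNS, §6.3–6.4; cell LADDER §50.3] -/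
def TubeStepLand (n : ℕ) : Prop :=
  ∀ z S₀ τ S F, HopPremise P 𝕊 ε₀ i₀ α X₀ w r c₀ ζ ustar n z S₀ τ S F →
    AnchorClause P i₀ (n + 1) (recentre S (rule.τ₁ n S) (rule.a n S)) ∧
    CoreClause P i₀ ustar (n + 1) (recentre S (rule.τ₁ n S) (rule.a n S)) ∧
    NearClause P i₀ ustar (n + 1) (recentre S (rule.τ₁ n S) (rule.a n S)) ∧
    BehindClause P ε₀ (n + 1) (recentre S (rule.τ₁ n S) (rule.a n S)) ∧
    AheadClause P w r (recentre S (rule.τ₁ n S) (rule.a n S))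

/-- Zone obligation ANCHOR (definitional for the canonical `a = |S i₀ 1 τ₁| / A_*`). [cite: Tao2016AveragedNS, §6.4; cell TRANSFER-CONSTANTS §4] -/
def TubeStepAnchor (n : ℕ) : Prop :=
  ∀ z S₀ τ S F, HopPremise P 𝕊 ε₀ i₀ α X₀ w r c₀ ζ ustar n z S₀ τ S F →
    AnchorClause P i₀ (n + 1) (recentre S (rule.τ₁ n S) (rule.a n S))

/-- Zone obligation CORE (L3 nonlinear hop + L4 persistence around `u⋆`, interface input from the near zone via
the stencil). [cite: Tao2016AveragedNS, §6.3–6.4; cell LADDER §47.5 L3/L4, §49.5 (b)] -/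
def TubeStepCore (n : ℕ) : Prop :=
  ∀ z S₀ τ S F, HopPremise P 𝕊 ε₀ i₀ α X₀ w r c₀ ζ ustar n z S₀ τ S F →
    CoreClause P i₀ ustar (n + 1) (recentre S (rule.τ₁ n S) (rule.a n S))

/-- Zone obligation NEAR-BEHIND (L8b: co-moving energy rate + two-zone loop). [cite: Tao2016AveragedNS, §6.3–6.4; cell LADDER §49] -/
def TubeStepNear (n : ℕ) : Prop :=
  ∀ z S₀ τ S F, HopPremise P 𝕊 ε₀ i₀ α X₀ w r c₀ ζ ustar n z S₀ τ S F →
    NearClause P i₀ ustar (n + 1) (recentre S (rule.τ₁ n S) (rule.a n S))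

/-- Zone obligation BEHIND (L6 freezing + energy bound; the index shift `k ↦ k-1` supplies the margin
`(1+ε₀)^{θ_b}` per hop against the rescaling `1/a`). [cite: Tao2016AveragedNS, §6.3–6.4; cell LADDER §47.5 L6, §50.3] -/
def TubeStepBehind (n : ℕ) : Prop :=
  ∀ z S₀ τ S F, HopPremise P 𝕊 ε₀ i₀ α X₀ w r c₀ ζ ustar n z S₀ τ S F →
    BehindClause P ε₀ (n + 1) (recentre S (rule.τ₁ n S) (rule.a n S))

/-- Zone obligation AHEAD (L1: leading-edge energy for exact flows; Gaussian weights). [cite: Tao2016AveragedNS, §6.2 Prop. 6.3 (ix); cell LADDER §47.5 L1] -/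
def TubeStepAhead (n : ℕ) : Prop :=
  ∀ z S₀ τ S F, HopPremise P 𝕊 ε₀ i₀ α X₀ w r c₀ ζ ustar n z S₀ τ S F →
    AheadClause P w r (recentre S (rule.τ₁ n S) (rule.a n S))

/-- The five zone obligations compose to the landing obligation. [cite: Tao2016AveragedNS, §6.3–6.4; cell LADDER §50.3] -/
theorem tubeStepLand_of_zones {n : ℕ}
    (hA : TubeStepAnchor P rule 𝕊 ε₀ i₀ α X₀ w r c₀ ζ ustar n)
    (hC : TubeStepCore P rule 𝕊 ε₀ i₀ α X₀ w r c₀ ζ ustar n)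
    (hN : TubeStepNear P rule 𝕊 ε₀ i₀ α X₀ w r c₀ ζ ustar n)
    (hB : TubeStepBehind P rule 𝕊 ε₀ i₀ α X₀ w r c₀ ζ ustar n)
    (hH : TubeStepAhead P rule 𝕊 ε₀ i₀ α X₀ w r c₀ ζ ustar n) :
    TubeStepLand P rule 𝕊 ε₀ i₀ α X₀ w r c₀ ζ ustar n :=
  fun z S₀ τ S F h => ⟨hA z S₀ τ S F h, hC z S₀ τ S F h, hN z S₀ τ S F h, hB z S₀ τ S F h, hH z S₀ τ S F h⟩

/-- STATICS of the described set (format clauses about `Z` alone: weights, tails, tameness, compatibility).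
[cite: Tao2016AveragedNS, §6.2–6.4 (statement shape); cell TRANSFER-CONSTANTS §2] -/
def TubeStatics (θ c : ℝ) : Prop :=
  0 < r ∧ 0 ≤ θ₀ ∧ θ₀ < θ ∧ θ ≤ 1 / 2 ∧ 0 < c₀ ∧ c₀ < c ∧ 0 < σ ∧ (∀ k, 1 ≤ w k) ∧
    TailFat ε₀ (tubeSet P ε₀ i₀ X₀ w r ζ ustar) w r ∧ TameBehind ε₀ (tubeSet P ε₀ i₀ X₀ w r ζ ustar) w ∧
    TailCompat ε₀ (tubeSet P ε₀ i₀ X₀ w r ζ ustar) w r env₀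

/-- EXISTENCE of exact format flows on `[0, c]` from the weighted `r`-ball around the tube (L2).
[cite: Tao2016AveragedNS, §4 Lemma 4.1 (local theory); cell LADDER §47.5 L2] -/
def TubeExist (c : ℝ) : Prop :=
  ∀ S₀ : Fin 2 → ℤ → ℝ,
    ballDesc (tubeSet P ε₀ i₀ X₀ w r ζ ustar) w r S₀ (fun i k => (1 / 2) * S₀ i k ^ 2) →
      ∃ S F : Fin 2 → ℤ → ℝ → ℝ,
        PseudoFlowOnShift 𝕊 c ε₀ α 0 0 S₀ (fun i k => (1 / 2) * S₀ i k ^ 2) (fun _ _ => 0) S F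

end Obligations

/-! ## The composition: `H(n)`-induction ⇒ format-v2 gap data with `Z := tubeSet`, `ρ := 0` -/

/-- One hop of the induction: under the clock, envelope and (capture | landing) obligations at hop `n`, from a
kicked flow out of a hop-`n` tube state the canonical checkpoint is a legal `StepTo` into the `0·r`-ball around the
tube (the re-centred state is a hop-`(n+1)` tube state), with slack. [cite: Tao2016AveragedNS, §6.4 Prop. 6.5 (statement shape); cell LADDER §50] -/
theorem stepTo_of_obligations (P : TubeSchedule) (rule : HopRule) {𝕊 : Finset (ℤ × ℤ × ℤ)} {σ ε₀ : ℝ}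
    {i₀ : Fin 2} {α : Fin 2 → Fin 2 → Fin 2 → ℤ × ℤ × ℤ → ℝ} {X₀ : Fin 2 → ℝ} {w : ℤ → ℝ} {r θ₀ c₀ : ℝ}
    {env₀ : ℤ → ℝ} {ζ : ℕ → Fin 2 → ℤ → ℝ} {ustar : Fin 2 → ℤ → ℝ} {n : ℕ}
    (hclock : TubeStepClock P rule 𝕊 σ ε₀ i₀ α X₀ w r θ₀ c₀ ζ ustar n)
    (henv : TubeStepEnvelope P rule 𝕊 ε₀ i₀ α X₀ w r c₀ env₀ ζ ustar n)
    (hcap : n + 1 ≤ P.N₀ → TubeStepCapture P rule 𝕊 ε₀ i₀ α X₀ w r c₀ ζ ustar n)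
    (hland : P.N₀ ≤ n → TubeStepLand P rule 𝕊 ε₀ i₀ α X₀ w r c₀ ζ ustar n)
    {z S₀ : Fin 2 → ℤ → ℝ} {τ : ℝ} {S F : Fin 2 → ℤ → ℝ → ℝ}
    (h : HopPremise P 𝕊 ε₀ i₀ α X₀ w r c₀ ζ ustar n z S₀ τ S F) :
    StepTo ε₀ θ₀ c₀ i₀ (ballDesc (tubeSet P ε₀ i₀ X₀ w r ζ ustar) w (0 * r)) (epochEnvelope env₀) S F
        (rule.τ₁ n S) (rule.a n S) ∧ (1 + σ) * rule.a n S ≤ |S i₀ 1 (rule.τ₁ n S)| := by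
  obtain ⟨h1, h2, h3, h4, h5, h6⟩ := hclock z S₀ τ S F h
  have hmem : recentre S (rule.τ₁ n S) (rule.a n S) ∈ tubeSet P ε₀ i₀ X₀ w r ζ ustar := by
    refine ⟨n + 1, ?_⟩
    by_cases hn : n + 1 ≤ P.N₀
    · have hc := hcap hn z S₀ τ S F h
      simp only [InTube, Nat.succ_ne_zero, if_false, if_pos hn]
      exact hc
    · have hl := hland (by omega) z S₀ τ S F h
      simp only [InTube, Nat.succ_ne_zero, if_false, if_neg hn]
      exact hl
  refine ⟨⟨h1, h2, h3, h4, h5, ?_, henv z S₀ τ S F h⟩, h6⟩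
  exact ballDesc_of_mem hmem (by simp) _

/-- **`H(n)`-INDUCTION ⇒ GAP DATA.** Statics + existence + the per-hop obligations for every `n` give format-v2
gap data for the table `α` on `𝕊` with the DESCRIBED reference set `Z := tubeSet …` and `ρ := 0`.
[cite: Tao2016AveragedNS, §6.3–6.4 Props. 6.4–6.5 (statement shape); cell LADDER §50] -/
theorem gapData₂On_of_tube (P : TubeSchedule) (rule : HopRule) {𝕊 : Finset (ℤ × ℤ × ℤ)} {σ ε₀ : ℝ}
    {i₀ : Fin 2} {α : Fin 2 → Fin 2 → Fin 2 → ℤ × ℤ × ℤ → ℝ} {X₀ : Fin 2 → ℝ} {w : ℤ → ℝ}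
    {r θ₀ θ c₀ c : ℝ} {env₀ : ℤ → ℝ} {ζ : ℕ → Fin 2 → ℤ → ℝ} {ustar : Fin 2 → ℤ → ℝ}
    (hstat : TubeStatics P σ ε₀ i₀ X₀ w r θ₀ c₀ env₀ ζ ustar θ c)
    (hexist : TubeExist P 𝕊 ε₀ i₀ α X₀ w r ζ ustar c)
    (hclock : ∀ n, TubeStepClock P rule 𝕊 σ ε₀ i₀ α X₀ w r θ₀ c₀ ζ ustar n)
    (henv : ∀ n, TubeStepEnvelope P rule 𝕊 ε₀ i₀ α X₀ w r c₀ env₀ ζ ustar n)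
    (hcap : ∀ n, n + 1 ≤ P.N₀ → TubeStepCapture P rule 𝕊 ε₀ i₀ α X₀ w r c₀ ζ ustar n)
    (hland : ∀ n, P.N₀ ≤ n → TubeStepLand P rule 𝕊 ε₀ i₀ α X₀ w r c₀ ζ ustar n) :
    GapData₂On 𝕊 σ ε₀ i₀ α X₀ (tubeSet P ε₀ i₀ X₀ w r ζ ustar) w r 0 θ₀ θ c₀ c env₀ := by
  obtain ⟨hr, hθ0, hθ, hθh, hc0, hc, hσ, hw, hfat, htame, hcompat⟩ := hstat
  have hstep' : ∀ (S₀ : Fin 2 → ℤ → ℝ) (τ : ℝ) (S F : Fin 2 → ℤ → ℝ → ℝ),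
      ballDesc (tubeSet P ε₀ i₀ X₀ w r ζ ustar) w r S₀ (fun i k => (1 / 2) * S₀ i k ^ 2) → c₀ ≤ τ →
        PseudoFlowOnShift 𝕊 τ ε₀ α 0 0 S₀ (fun i k => (1 / 2) * S₀ i k ^ 2) (fun _ _ => 0) S F →
          ∃ τ₁ a : ℝ, StepTo ε₀ θ₀ c₀ i₀ (ballDesc (tubeSet P ε₀ i₀ X₀ w r ζ ustar) w (0 * r))
            (epochEnvelope env₀) S F τ₁ a ∧ (1 + σ) * a ≤ |S i₀ 1 τ₁| := by
    intro S₀ τ S F hball hτ hflow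
    obtain ⟨z, ⟨n, hz⟩, hkick⟩ := hball
    exact ⟨rule.τ₁ n S, rule.a n S,
      stepTo_of_obligations P rule (hclock n) (henv n) (hcap n) (hland n) ⟨hz, hkick, hτ, hflow⟩⟩
  refine ⟨⟨hr, le_rfl, zero_lt_one, hθ0, hθ, hθh, hc0, hc, hw, datum_mem_tubeSet P ε₀ i₀ X₀ w r ζ ustar, hfat,
    hexist, ?_⟩, hσ, htame, hstep', hcompat⟩
  intro S₀ τ S F hball hτ hflow
  obtain ⟨τ₁, a, hst, -⟩ := hstep' S₀ τ S F hball hτ hflow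
  exact ⟨τ₁, a, hst⟩

/-- The child-2 shape: for the graded MIRROR table, `H(n)`-induction data at one `ε₀` give the `∃`-clause of
`GradedAdiabaticWake`'s conclusion at that `ε₀` (with `ρ' = 0`), given `TailThin` for the chosen weights.
[cite: Tao2016AveragedNS, §6.3–6.4 (statement shape); cell LADDER §50; route TaoLadderRungTwoFlat item GradedAdiabaticWake] -/
theorem gradedWake_clause_of_tube (P : TubeSchedule) (rule : HopRule) {σ ε ε₀ : ℝ} {i₀ : Fin 2}
    {X₀ : Fin 2 → ℝ} {w : ℤ → ℝ} {r θ₀ θ c₀ c : ℝ} {env₀ : ℤ → ℝ} {ζ : ℕ → Fin 2 → ℤ → ℝ}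
    {ustar : Fin 2 → ℤ → ℝ}
    (hstat : TubeStatics P σ ε₀ i₀ X₀ w r θ₀ c₀ env₀ ζ ustar θ c)
    (hexist : TubeExist P shiftSetFlat ε₀ i₀ (mirrorTable ε ε) X₀ w r ζ ustar c)
    (hclock : ∀ n, TubeStepClock P rule shiftSetFlat σ ε₀ i₀ (mirrorTable ε ε) X₀ w r θ₀ c₀ ζ ustar n)
    (henv : ∀ n, TubeStepEnvelope P rule shiftSetFlat ε₀ i₀ (mirrorTable ε ε) X₀ w r c₀ env₀ ζ ustar n)
    (hcap : ∀ n, n + 1 ≤ P.N₀ → TubeStepCapture P rule shiftSetFlat ε₀ i₀ (mirrorTable ε ε) X₀ w r c₀ ζ ustar n)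
    (hland : ∀ n, P.N₀ ≤ n → TubeStepLand P rule shiftSetFlat ε₀ i₀ (mirrorTable ε ε) X₀ w r c₀ ζ ustar n)
    (hthin : TailThin ε₀ w r) :
    ∃ (σ' : ℝ) (Z : Set (Fin 2 → ℤ → ℝ)) (w' : ℤ → ℝ) (r' ρ' θ₀' θ' c₀' c' : ℝ) (env₀' : ℤ → ℝ),
      GapData₂On shiftSetFlat σ' ε₀ i₀ (mirrorTable ε ε) X₀ Z w' r' ρ' θ₀' θ' c₀' c' env₀' ∧ TailThin ε₀ w' r' :=
  ⟨σ, tubeSet P ε₀ i₀ X₀ w r ζ ustar, w, r, 0, θ₀, θ, c₀, c, env₀,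
    gapData₂On_of_tube P rule hstat hexist hclock henv hcap hland, hthin⟩


end Summit.NavierStokesRegularity.NavierStokesRegularity.Theorems.HopTube

end
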